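import Summits.BirchSwinnertonDyer.BirchSwinnertonDyer.Theorems.GenusKolyvaginAtTwoPowDvdShaCardAtTwoRTDoubleKill
import Summits.BirchSwinnertonDyer.BirchSwinnertonDyer.Theorems.GenusKolyvaginAtTwoPowDvdShaCardAtTwoRTLevelRange
import Summits.BirchSwinnertonDyer.BirchSwinnertonDyer.Theorems.GenusKolyvaginAtTwoEquivariantKolyvaginExactAtTwoLocalDualityOrder
import Summits.BirchSwinnertonDyer.Rank1Residual.X11b.BDPRouteRelaxation
import Literature.NumberTheory.EllipticCurves.CasselsTateSelmerKolyvaginValue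
import HarnessLib

/-!
# Route `GenusKolyvaginAtTwo`, crux L_T `PowDvdShaCardAtTwoRT` (stmt-BirchSwinnertonDyer-23242), LINE 18 stub L, bottom rung:
# THE `ℓ′`-TERM IS NON-ZERO — `hgen` (the auxiliary class generates `H¹_f` at the new prime) and the `hℓ′` glue

LEAD seat `bsd-line-gk2-p1` g16 (cell `bsd-f1-sign2`), `--supports 23242 --as helper`.  THEOREMS ONLY; no `sorry`; standard axioms.
BSD is NOT proved by any of this; neither is the crux nor stub L.

WHY (memo `Cruxes/PowDvdShaCardAtTwoRT/Lines/plus-descent-lead-g16.md` §2, §10).  `…RTBottomRungReciprocity.false_of_bottomRung` displays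
`hl' : inv_{ℓ′}(loc (2•Z) ∪ₑ loc y) ≠ 0`; `…RTDoubleKill.pairing_two_nsmul_ne_zero_of_lagrangian` reduces it to four local facts at `ℓ′`:
(hF) `{}^⊥𝓛_{ℓ′} ≤ 𝓛_{ℓ′}` (the Kummer condition is coisotropic for the local pairing), (hgen) every element of `𝓛_{ℓ′}` is a multiple of
`loc_{ℓ′} y`, (hmeet) `⟨loc Z⟩ ∩ 𝓛 = 0`, (hz) `2 • loc Z ≠ 0`.  (hmeet)/(hz) come from Q2 over `K` (`…RTBottomRungLocalInputs`); this file
supplies (hgen) from the Čebotarev choice of `ℓ′` and assembles `hl'`: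
* §1 `forall_mem_exists_eq_zsmul_of_addOrderOf_eq_natCard` — group theory: `z ∈ F`, `addOrderOf z = #F` ⟹ `F = ℤ•z`;
  `addOrderOf_localization_eq_two_pow` — `addOrderOf (loc_v y) = 2^M` from the order clause «`2^j • y ∈ torsionLocalKer_v ↔ M ≤ j`»
  (the shape delivered by `EquivariantChebotarevAtTwoR` + the LINE 6 dictionary), any number field;
* §2 over `ℚ` at a Gross–Kolyvagin prime of depth `≥ M` (`Δ < 0`): **`forall_mem_kummerSelmerStructure_exists_eq_zsmul`** — (hgen): `y` Kummer
  at `ℓ′` with that order clause generates `𝓛_{ℓ′}` (`#𝓛_{ℓ′} = 2^M`, `LocalDualityOrder.natCard_kummerLocalConditionAt_two_pow_eq`);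
* §3 **`invWeilPairing_localization_ne_zero_of_newPrime`** — `hl'` from (hF) displayed, (hgen) of §2, (hmeet), (hz).
Namespace `…Theorems.GenusExact.RelaxedCount`.  Closes nothing.  BSD is NOT proved by any of this.

References: [McCallumLMS1991] §5 Lemma 5.3 and proof of Prop. 5.2; [GrossLMS1991] Prop. 6.2, §9; [MilneADT2006] I Cor. 3.4.
-/

set_option autoImplicit false
-- the Theorems namespace of this sub repeats the summit name by design (D-0017 nested layout)
set_option linter.dupNamespace false

noncomputable section

open scoped Classical

open Field NumberField IsDedekindDomain Function WeierstrassCurve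
open Literature.NumberTheory.EllipticCurves
open Literature.NumberTheory.GaloisRepresentations
open Literature.NumberTheory.GaloisCohomology
open Summit.BirchSwinnertonDyer.Rank1Residual.X11b.FiniteDuality
open Summit.BirchSwinnertonDyer.Rank1Residual.X11b.Relaxation

namespace Summit.BirchSwinnertonDyer.BirchSwinnertonDyer.Theorems.GenusExact.RelaxedCount

/-! ## §1 Group theory and the local order -/

section Orders

/-- **An element of `F` whose order is `#F` generates `F`**: every `f ∈ F` is `k • z`. [folklore] -/
theorem forall_mem_exists_eq_zsmul_of_addOrderOf_eq_natCard {V : Type*} [AddCommGroup V] (F : AddSubgroup V) [Finite F] {z : V}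
    (hz : z ∈ F) (hord : addOrderOf z = Nat.card F) : ∀ f ∈ F, ∃ k : ℤ, f = k • z := by
  have hle : AddSubgroup.zmultiples z ≤ F := AddSubgroup.zmultiples_le_of_mem hz
  have heq : AddSubgroup.zmultiples z = F :=
    AddSubgroup.eq_of_le_of_card_ge hle (by rw [Nat.card_zmultiples, hord])
  intro f hf
  rw [← heq, AddSubgroup.mem_zmultiples_iff] at hf
  obtain ⟨k, hk⟩ := hf
  exact ⟨k, hk.symm⟩

variable {K : Type} [Field K] [NumberField K] (W : WeierstrassCurve K) [W.IsElliptic]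

/-- **`addOrderOf (loc_v y) = 2^M` from the order clause** «`2^j • y ∈ torsionLocalKer_v ↔ M ≤ j`» (`M ≥ 1`): `2^M • loc y = 0` and
`2^(M-1) • loc y ≠ 0` (`mem_torsionLocalKer_iff_res_eq_zero`), so `addOrderOf_eq_prime_pow`. [cite: McCallumLMS1991, §3 (3) and Thm. 3.1] -/
theorem addOrderOf_localization_eq_two_pow (q : ℕ) [NeZero q] {M : ℕ} (hM : 1 ≤ M) (v : HeightOneSpectrum (𝓞 K))
    (y : galoisCohomology (W.torsionGaloisModule (q : ℤ)) 1)
    (hOrd : ∀ j : ℕ, ((2 ^ j : ℕ) : ℤ) • y ∈ W.torsionLocalKer (v.adicCompletion K) (q : ℤ) ↔ M ≤ j) :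
    addOrderOf (galoisCohomology.localization (W.torsionGaloisModule (q : ℤ)) (Sum.inr v) 1 y) = 2 ^ M := by
  haveI : CharZero (v.adicCompletion K) := charZero_of_injective_algebraMap (algebraMap K (v.adicCompletion K)).injective
  haveI : Fact (Nat.Prime 2) := ⟨Nat.prime_two⟩
  have hloc : ∀ j : ℕ, (2 ^ j) • galoisCohomology.localization (W.torsionGaloisModule (q : ℤ)) (Sum.inr v) 1 y = 0 ↔ M ≤ j := by
    intro j
    rw [← hOrd j, ← natCast_zsmul, ← map_zsmul, Nat.cast_pow, Nat.cast_ofNat]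
    refine ((mem_torsionLocalKer_iff_res_eq_zero W (v.adicCompletion K) (NeZero.ne q) _).trans ?_).symm
    exact Iff.rfl
  obtain ⟨m, rfl⟩ : ∃ m, M = m + 1 := ⟨M - 1, by omega⟩
  refine addOrderOf_eq_prime_pow (fun h ↦ ?_) ((hloc (m + 1)).mpr le_rfl)
  have := (hloc m).mp h
  omega

end Orders

/-! ## §2 Over `ℚ`: the auxiliary class generates `H¹_f` at the new prime -/

section Rat

variable (W : WeierstrassCurve ℚ) [W.IsElliptic] [W.IsGloballyMinimal]

/-- **(hgen) at a Gross–Kolyvagin prime of depth `≥ M`.**  `Δ(E) < 0`; `ℓ ≠ 2` good with `Frob_ℓ = Frob_∞` and `M ≤ kolyvaginIndex`,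
`ℓ ∈ v`; `y ∈ H¹(ℚ, E[2^M])` Kummer at `v` whose localisation has the order clause with exponent `M ≥ 1`.  Then every class of the Kummer group
`𝓛_v` is an integer multiple of `loc_v y`: `#𝓛_v = 2^M` (`natCard_kummerLocalConditionAt_two_pow_eq`) `= addOrderOf (loc_v y)` (§1).
[cite: McCallumLMS1991, §5 Lemma 5.3] [cite: GrossLMS1991, Prop. 6.2] -/
theorem forall_mem_kummerSelmerStructure_exists_eq_zsmul (hΔ : W.Δ < 0) {K : Type} [Field K] [NumberField K]
    {ℓ : ℕ} [Fact ℓ.Prime] (hℓ2 : ℓ ≠ 2) (hgoodℓ : W.HasGoodReductionAtPrime ℓ) (hℓ : FrobEqFrobInfty W K 2 ℓ)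
    {v : HeightOneSpectrum (𝓞 ℚ)} (hv : (ℓ : 𝓞 ℚ) ∈ v.asIdeal) {M : ℕ} (hM : 1 ≤ M) (hMi : M ≤ Zhang2014.kolyvaginIndex W 2 ℓ)
    {q : ℕ} (hq : q = 2 ^ M) [NeZero q] (y : galoisCohomology (W.torsionGaloisModule (q : ℤ)) 1)
    (hyK : y ∈ selmerLocalKer W (v.adicCompletion ℚ) (q : ℤ))
    (hOrd : ∀ j : ℕ, ((2 ^ j : ℕ) : ℤ) • y ∈ W.torsionLocalKer (v.adicCompletion ℚ) (q : ℤ) ↔ M ≤ j) :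
    ∀ f ∈ W.kummerSelmerStructure (q : ℤ) (Sum.inr v : Place ℚ),
      ∃ k : ℤ, f = k • galoisCohomology.localization (W.torsionGaloisModule (q : ℤ)) (Sum.inr v) 1 y := by
  have hcard : Nat.card (W.kummerSelmerStructure (q : ℤ) (Sum.inr v : Place ℚ)) = 2 ^ M := by
    subst hq
    exact LocalDualityOrder.natCard_kummerLocalConditionAt_two_pow_eq W hΔ hℓ2 hgoodℓ hℓ hv hMi
  haveI : Finite (W.kummerSelmerStructure (q : ℤ) (Sum.inr v : Place ℚ)) :=
    Nat.finite_of_card_ne_zero (by rw [hcard]; exact pow_ne_zero M two_ne_zero)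
  refine forall_mem_exists_eq_zsmul_of_addOrderOf_eq_natCard (W.kummerSelmerStructure (q : ℤ) (Sum.inr v : Place ℚ))
    ((res_mem_kummerLocalConditionAt_iff W (q : ℤ) (Place.Completion (Sum.inr v : Place ℚ)) y).mpr hyK) ?_
  rw [hcard]
  exact addOrderOf_localization_eq_two_pow W q hM v y hOrd

end Rat

/-! ## §3 The `ℓ′`-term of the `X = 2Z` reciprocity is non-zero -/

section NewPrime

variable (W : WeierstrassCurve ℚ) [W.IsElliptic] [W.IsGloballyMinimal]
variable (n : ℕ) [NeZero n]
variable (e : W.geomTorsion n → W.geomTorsion n → AlgebraicClosure ℚ)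
  (hμ : ∀ S T, e S T ^ n = 1)
  (hadd₁ : ∀ S₁ S₂ T, e (S₁ + S₂) T = e S₁ T * e S₂ T)
  (hadd₂ : ∀ S T₁ T₂, e S (T₁ + T₂) = e S T₁ * e S T₂)
  (hgal : ∀ (σ : absoluteGaloisGroup ℚ) (S T : W.geomTorsion n), σ • e S T = e (σ • S) (σ • T))

/-- **`hl'` of `false_of_bottomRung`.**  At the new deep prime `ℓ′ = ℓ` (Gross–Kolyvagin, depth `≥ M`, `n = 2^M`, `Δ < 0`), with `inv` any
family of local invariant maps: if (hF) the Kummer group `𝓛_{ℓ′}` contains its left annihilator for `inv_{ℓ′}(· ∪ₑ ·)`, the auxiliary `y`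
is Kummer at `ℓ′` with the order clause of exponent `M` (so (hgen) by §2), and the descended class `Z` satisfies (hmeet) «multiples of
`loc Z` in `𝓛` vanish» and (hz) `2 • loc Z ≠ 0`, then **`inv_{ℓ′}(loc (2•Z) ∪ₑ loc y) ≠ 0`** (`pairing_two_nsmul_ne_zero_of_lagrangian`).
[cite: McCallumLMS1991, §5 Lemma 5.3 and proof of Prop. 5.2] -/
theorem invWeilPairing_localization_ne_zero_of_newPrime (hΔ : W.Δ < 0) {K : Type} [Field K] [NumberField K]
    {ℓ : ℕ} [Fact ℓ.Prime] (hℓ2 : ℓ ≠ 2) (hgoodℓ : W.HasGoodReductionAtPrime ℓ) (hℓ : FrobEqFrobInfty W K 2 ℓ)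
    {v : HeightOneSpectrum (𝓞 ℚ)} (hv : (ℓ : 𝓞 ℚ) ∈ v.asIdeal) {M : ℕ} (hM : 1 ≤ M) (hMi : M ≤ Zhang2014.kolyvaginIndex W 2 ℓ)
    (hn : n = 2 ^ M) (inv : LocalInvariants ℚ n)
    (hF : annLeft (invWeilPairing W n e hμ hadd₁ hadd₂ hgal inv (Sum.inr v)) (W.kummerSelmerStructure (n : ℤ) (Sum.inr v : Place ℚ)) ≤
      W.kummerSelmerStructure (n : ℤ) (Sum.inr v : Place ℚ))
    {Z y : galoisCohomology (W.torsionGaloisModule (n : ℤ)) 1}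
    (hyK : y ∈ selmerLocalKer W (v.adicCompletion ℚ) (n : ℤ))
    (hOrd : ∀ j : ℕ, ((2 ^ j : ℕ) : ℤ) • y ∈ W.torsionLocalKer (v.adicCompletion ℚ) (n : ℤ) ↔ M ≤ j)
    (hmeet : ∀ k : ℤ, k • galoisCohomology.localization (W.torsionGaloisModule (n : ℤ)) (Sum.inr v) 1 Z ∈
        W.kummerSelmerStructure (n : ℤ) (Sum.inr v : Place ℚ) →
      k • galoisCohomology.localization (W.torsionGaloisModule (n : ℤ)) (Sum.inr v) 1 Z = 0)
    (hz : (2 : ℤ) • galoisCohomology.localization (W.torsionGaloisModule (n : ℤ)) (Sum.inr v) 1 Z ≠ 0) :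
    invWeilPairing W n e hμ hadd₁ hadd₂ hgal inv (Sum.inr v)
      (galoisCohomology.localization (W.torsionGaloisModule (n : ℤ)) (Sum.inr v) 1 ((2 : ℕ) • Z))
      (galoisCohomology.localization (W.torsionGaloisModule (n : ℤ)) (Sum.inr v) 1 y) ≠ 0 := by
  rw [map_nsmul]
  exact pairing_two_nsmul_ne_zero_of_lagrangian _ _ hF
    (forall_mem_kummerSelmerStructure_exists_eq_zsmul W hΔ hℓ2 hgoodℓ hℓ hv hM hMi hn y hyK hOrd) hmeet hz

end NewPrime

end Summit.BirchSwinnertonDyer.BirchSwinnertonDyer.Theorems.GenusExact.RelaxedCount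

end
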